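import Mathlib
import Literature.Analysis.FluidPDE.LocalEnergyEqualityL4
import Literature.Analysis.FluidPDE.SpaceTimeRescaling
import Summits.NavierStokesRegularity.NavierStokesRegularity.Theorems.EulerZoomLiouvillePowerGaugeEulerLiouvilleSelfSimilarPressureSlaving
import Summits.NavierStokesRegularity.NavierStokesRegularity.Theorems.EulerZoomLiouvillePowerGaugeEulerLiouvilleWindowIdentity
import HarnessLib

/-!
# THE LIONS GATE: an `L⁴_loc` member of Seregin's power-gauged ancient Euler class is CONSERVATIVE
# (crux `EulerZoomLiouville.PowerGaugeEulerLiouville` = stmt-NavierStokesRegularity-19832; line `lions-gate`, stub O1 `stub_lionsGate`,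
# LEAD ns-typeII-p2 g12 15:23:30Z «land O1 … BY NAME»; width seat ns-ezl-w1 g4)

Route №10 `EulerZoomLiouville` (NavierStokesRegularity).  J.-L. Lions (1960) / Shinbrot (1974): weak Navier–Stokes solutions in
`L⁴ₜ,ₓ` satisfy the energy EQUALITY; the viscosity is used only to put `∇u` in `L²`.  In the crux class — suitable weak EULER
solutions on the slab `(−∞,0) × ℝ³` with a weak spatial gradient `H` and the power gauge
`a^{2ρ}A(a) + a^{ρ}E(a) + a^{2ρ}D(a) ≤ c` at every scale `a > 0` about the origin — the `E`-gauge supplies `∇u ∈ L²` on every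
parabolic cylinder `Q_a(0,0)`, with no viscosity.  Hence (**`isEnergyConservative_of_memL4Loc`** = `Sig.stub_lionsGate` of
`Cruxes/PowerGaugeEulerLiouville/Lines/lions_gate.lean` BY NAME, bodies verbatim): a member with
`u ∈ L⁴((−a²,0) × B_a)` for every `a > 0` satisfies the LOCAL ENERGY EQUALITY
`∫ dt ∫ dx (|u|² ∂ₜφ + (|u|² + 2p) ⟪u, ∇φ⟫) = 0` for every test function `φ` on the slab — integrability GATES anomalous
dissipation inside the class (the dissipative residue of the crux consists of `L⁴`-rough members only).

Proof: given `φ`, its compact support lies in some `Q_R(0,0)`; the parabolic rescaling `v = R u(R²s, Ry)`, `q = R² p(R²s, Ry)`,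
`G = R² H(R²s, Ry)` (tree `FluidPDE/SpaceTimeRescaling`: `IsDistributionalNSSolutionOn.stRescale`, `HasWeakSpatialGradientOn.stRescale`,
`setLIntegral_frobeniusNormSq_stRescale`, `setLIntegral_enorm_rpow_stRescale`, `ae_sliced_setLIntegral_ball_stRescale`) is a
distributional Euler solution on the unit cylinder `Q₁` with `v ∈ L_{2,∞} ∩ L⁴`, `G ∈ L²`, `q ∈ L^{3/2}` (from `A(R), E(R), D(R) < ∞` and
the `L⁴` hypothesis at scale `R`); the LIONS GATE ON THE UNIT CYLINDER (`Literature/…/LocalEnergyEqualityL4`,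
`integral_integral_localEnergy_eq_of_L4` with `ν = 0`, this seat) gives the identity for the pulled-back test `φ ∘ Φ`, and the
change of variables `integral_integral_comp_stAffine` pulls it back.

HONEST LABEL: structure theorem for the class (touches no needle: self-similar `C²` members are classical hence conservative anyway).
WHAT THIS IS NOT: not NS, not E — `--supports` stmt-19832; 19832 OPEN; NS regularity NOT proved.
[cite: EscauriazaSereginSverak2003, §3; folklore (Lions 1960, Shinbrot 1974, CKN 1982 §2 scaling)]
-/

noncomputable section

-- flat `Theorems/<Route><Decl>…` files of one crux share the namespace of the crux (tree convention)
set_option linter.dupNamespace false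

open MeasureTheory Set Filter Topology Metric Function InnerProductSpace TopologicalSpace
open scoped RealInnerProductSpace NNReal ENNReal Laplacian

namespace Summit.NavierStokesRegularity.NavierStokesRegularity.Theorems.PowerGaugeEulerLiouville.LionsGate

open Literature.Analysis Literature.Analysis.FluidPDE

/-! ### Plumbing: finiteness from products, the unit cylinder as a preimage -/

/-- If `a ≠ 0` and `a * b ≤ c` with `c` finite then `b < ∞`. [folklore] -/
theorem lt_top_of_mul_le {a b : ℝ≥0∞} {c : ℝ≥0} (ha : a ≠ 0) (h : a * b ≤ (c : ℝ≥0∞)) : b < ⊤ := by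
  by_contra hb
  rw [not_lt, top_le_iff] at hb
  rw [hb, ENNReal.mul_top ha] at h
  exact absurd h (not_le.2 ENNReal.coe_lt_top)

/-- `b ≤ a * ((a⁻¹) * b)`-type rearrangement: from the scaled quantity `a⁻¹ * I` back to `I ≤ a * (a⁻¹ * I)` (`a ≠ 0, ∞`). [folklore] -/
theorem le_mul_inv_mul {a I : ℝ≥0∞} (ha : a ≠ 0) (ha' : a ≠ ⊤) : I ≤ a * (a⁻¹ * I) := by
  rw [← mul_assoc, ENNReal.mul_inv_cancel ha ha', one_mul]

/-- The parabolic rescaling `Φ(s, y) = (R² s, R y)` takes the unit cylinder onto `Q_R(0,0)`: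
`Φ⁻¹((−R², 0) × B_R) = (−1, 0) × B₁`. [folklore] -/
theorem stAffine_preimage_cylinder_unit {R : ℝ} (hR : 0 < R) :
    stAffine (R ^ 2) R 0 (0 : EuclideanSpace ℝ (Fin 3)) ⁻¹'
        (Ioo (-(R ^ 2)) 0 ×ˢ ball (0 : EuclideanSpace ℝ (Fin 3)) R) =
      Ioo (-1 : ℝ) 0 ×ˢ ball (0 : EuclideanSpace ℝ (Fin 3)) 1 := by
  have hR2 : 0 < R ^ 2 := by positivity
  rw [stAffine_preimage_cylinder hR2 hR]
  have e1 : (-(R ^ 2) - 0) / R ^ 2 = (-1 : ℝ) := by rw [sub_zero, neg_div, div_self hR2.ne']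
  have e2 : ((0 : ℝ) - 0) / R ^ 2 = 0 := by simp
  have e3 : R⁻¹ • ((0 : EuclideanSpace ℝ (Fin 3)) - 0) = 0 := by simp
  have e4 : R / R = (1 : ℝ) := div_self hR.ne'
  rw [e1, e2, e3, e4]

/-- The parabolic cylinder `Q_R(0,0)` is `(−R², 0) × B_R`. [folklore] -/
theorem parabolicCylinder_zero (R : ℝ) :
    parabolicCylinder R ((0 : ℝ), (0 : EuclideanSpace ℝ (Fin 3))) =
      Ioo (-(R ^ 2)) 0 ×ˢ ball (0 : EuclideanSpace ℝ (Fin 3)) R := by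
  simp [parabolicCylinder]

/-- The same with the centre written as the zero of `ℝ × ℝ³`. [folklore] -/
theorem parabolicCylinder_zero' (R : ℝ) :
    parabolicCylinder R (0 : ℝ × EuclideanSpace ℝ (Fin 3)) =
      Ioo (-(R ^ 2)) 0 ×ˢ ball (0 : EuclideanSpace ℝ (Fin 3)) R := by
  simp [parabolicCylinder]

/-- The unit cylinder `Q₁(0,0)` lies in the slab `(−∞, 0) × ℝ³`. [folklore] -/
theorem parabolicCylinderOpens_one_le_slab :
    parabolicCylinderOpens 1 ((0 : ℝ), (0 : EuclideanSpace ℝ (Fin 3))) ≤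
      slab (EuclideanSpace ℝ (Fin 3)) (Iio 0) isOpen_Iio := by
  intro z hz
  have hz' : z ∈ parabolicCylinder 1 ((0 : ℝ), (0 : EuclideanSpace ℝ (Fin 3))) := hz
  rw [parabolicCylinder_one_zero] at hz'
  show z ∈ ((slab (EuclideanSpace ℝ (Fin 3)) (Iio 0) isOpen_Iio : Opens (ℝ × EuclideanSpace ℝ (Fin 3))) :
    Set (ℝ × EuclideanSpace ℝ (Fin 3)))
  rw [coe_slab]
  exact ⟨hz'.1.2, mem_univ _⟩

/-! ### The Lions gate (stub O1 of line `lions-gate`, by name) -/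

/-- **THE LIONS GATE** (`Sig.stub_lionsGate` of `Cruxes/PowerGaugeEulerLiouville/Lines/lions_gate.lean`, BODIES VERBATIM:
`InClass ρ u p H c → MemL4Loc u → IsEnergyConservative u p`).  A member of Seregin's power-gauged ancient Euler class on the slab
`(−∞,0) × ℝ³` (suitable weak Euler solution, weak spatial gradient `H`, power gauge `≤ c` at every scale about the origin — for ANY
real `ρ`) with `u ∈ L⁴((−a², 0) × B_a)` for every `a > 0` satisfies the local energy EQUALITY: for every test function `φ` on the slab,
`∫ dt ∫ dx (|u|²∂ₜφ + (|u|² + 2p)⟪u, ∇φ⟫) = 0`.  Lions 1960 / Shinbrot 1974 with the `E`-gauge in place of the viscosity; proof by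
parabolic rescaling of a cylinder containing `supp φ` onto the unit cylinder and the Lions gate there
(`integral_integral_localEnergy_eq_of_L4`, `ν = 0`). [folklore; EscauriazaSereginSverak2003 §3] -/
theorem isEnergyConservative_of_memL4Loc (ρ : ℝ)
    (u : ℝ → EuclideanSpace ℝ (Fin 3) → EuclideanSpace ℝ (Fin 3)) (p : ℝ → EuclideanSpace ℝ (Fin 3) → ℝ)
    (H : ℝ → EuclideanSpace ℝ (Fin 3) → EuclideanSpace ℝ (Fin 3) →L[ℝ] EuclideanSpace ℝ (Fin 3)) (c : ℝ≥0) :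
    (IsSuitableWeakSolutionOn (slab (EuclideanSpace ℝ (Fin 3)) (Set.Iio 0) isOpen_Iio) 0 0 u p ∧
      HasWeakSpatialGradientOn (slab (EuclideanSpace ℝ (Fin 3)) (Set.Iio 0) isOpen_Iio) u H ∧
      (∀ a : ℝ, 0 < a →
        ENNReal.ofReal (a ^ (2 * ρ)) * cknA a (0 : ℝ × EuclideanSpace ℝ (Fin 3)) u +
            ENNReal.ofReal (a ^ ρ) * cknE a (0 : ℝ × EuclideanSpace ℝ (Fin 3)) H +
          ENNReal.ofReal (a ^ (2 * ρ)) * cknD a (0 : ℝ × EuclideanSpace ℝ (Fin 3)) p ≤ (c : ℝ≥0∞))) →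
    (∀ a : ℝ, 0 < a →
      ∫⁻ z in Set.Ioo (-(a ^ 2)) 0 ×ˢ Metric.ball (0 : EuclideanSpace ℝ (Fin 3)) a, ‖u z.1 z.2‖ₑ ^ (4 : ℕ) < ⊤) →
    ∀ φ : ℝ → EuclideanSpace ℝ (Fin 3) → ℝ,
      IsSpaceTimeTestOn (slab (EuclideanSpace ℝ (Fin 3)) (Set.Iio 0) isOpen_Iio) φ →
      ∫ t, ∫ x, (‖u t x‖ ^ 2 * timeDeriv φ t x + (‖u t x‖ ^ 2 + 2 * p t x) * ⟪u t x, gradient (φ t) x⟫) = 0 := by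
  rintro ⟨hsw, hH, hgauge⟩ hL4 φ hφ
  -- ### (1) a cylinder `Q_R(0,0)` containing the support of `φ`
  set K : Set (ℝ × EuclideanSpace ℝ (Fin 3)) := tsupport (uncurry φ) with hK
  have hKc : IsCompact K := hφ.hasCompactSupport
  have hKslab : K ⊆ Iio (0 : ℝ) ×ˢ (univ : Set (EuclideanSpace ℝ (Fin 3))) := by
    intro z hz
    have h := hφ.tsupport_subset hz
    rw [coe_slab] at h
    exact h
  obtain ⟨M, hM⟩ := hKc.isBounded.subset_closedBall (0 : ℝ × EuclideanSpace ℝ (Fin 3))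
  set R : ℝ := max M 0 + 1 with hRdef
  have hR : 0 < R := by rw [hRdef]; linarith [le_max_right M 0]
  have hR1 : 1 ≤ R := by rw [hRdef]; linarith [le_max_right M 0]
  have hRM : M < R := by rw [hRdef]; linarith [le_max_left M 0]
  have hR2 : 0 < R ^ 2 := by positivity
  have hKQ : K ⊆ Ioo (-(R ^ 2)) 0 ×ˢ ball (0 : EuclideanSpace ℝ (Fin 3)) R := by
    intro z hz
    have hzM : ‖z‖ ≤ M := by simpa [mem_closedBall, dist_zero_right] using hM hz
    have hz1 : |z.1| ≤ M := (norm_fst_le z).trans hzM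
    have hz2 : ‖z.2‖ ≤ M := (norm_snd_le z).trans hzM
    have hzt : z.1 < 0 := (hKslab hz).1
    refine ⟨⟨?_, hzt⟩, ?_⟩
    · have h1 : -M ≤ z.1 := by linarith [neg_abs_le z.1]
      have h2 : M < R ^ 2 := by nlinarith
      linarith
    · rw [mem_ball_zero_iff]; linarith
  -- ### (2) the rescaled fields on the unit cylinder
  set β : ℝ := R ^ 2 with hβdef
  have hβ : 0 < β := hR2
  have hβeq : β = R * R := by rw [hβdef]; ring
  set v : ℝ → EuclideanSpace ℝ (Fin 3) → EuclideanSpace ℝ (Fin 3) :=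
    R • stPull β R 0 (0 : EuclideanSpace ℝ (Fin 3)) u with hvdef
  set q : ℝ → EuclideanSpace ℝ (Fin 3) → ℝ := R ^ 2 • stPull β R 0 (0 : EuclideanSpace ℝ (Fin 3)) p with hqdef
  set G : ℝ → EuclideanSpace ℝ (Fin 3) → EuclideanSpace ℝ (Fin 3) →L[ℝ] EuclideanSpace ℝ (Fin 3) :=
    (R * R) • stPull β R 0 (0 : EuclideanSpace ℝ (Fin 3)) H with hGdef
  set ψ : ℝ → EuclideanSpace ℝ (Fin 3) → ℝ := stPull β R 0 (0 : EuclideanSpace ℝ (Fin 3)) φ with hψdef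
  have hpre : stAffine β R 0 (0 : EuclideanSpace ℝ (Fin 3)) ⁻¹'
      (Ioo (-(R ^ 2)) 0 ×ˢ ball (0 : EuclideanSpace ℝ (Fin 3)) R) =
      Ioo (-1 : ℝ) 0 ×ˢ ball (0 : EuclideanSpace ℝ (Fin 3)) 1 := stAffine_preimage_cylinder_unit hR
  have hQ1 : parabolicCylinder 1 ((0 : ℝ), (0 : EuclideanSpace ℝ (Fin 3))) =
      Ioo (-1 : ℝ) 0 ×ˢ ball (0 : EuclideanSpace ℝ (Fin 3)) 1 := parabolicCylinder_one_zero
  have hQR : parabolicCylinder R ((0 : ℝ), (0 : EuclideanSpace ℝ (Fin 3))) =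
      Ioo (-(R ^ 2)) 0 ×ˢ ball (0 : EuclideanSpace ℝ (Fin 3)) R := parabolicCylinder_zero R
  -- (2a) distributional Euler solution on the unit cylinder
  have hNS : IsDistributionalNSSolutionOn (parabolicCylinderOpens 1 ((0 : ℝ), (0 : EuclideanSpace ℝ (Fin 3)))) 0 0 v q := by
    have h := hsw.distributional.stRescale hR hR hβeq 0 (0 : EuclideanSpace ℝ (Fin 3))
    have h0 : ((R ^ 2 * R) • stPull β R 0 (0 : EuclideanSpace ℝ (Fin 3))
        (0 : ℝ → EuclideanSpace ℝ (Fin 3) → EuclideanSpace ℝ (Fin 3))) = 0 := by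
      funext s y
      rw [smul_stPull_apply]
      simp
    rw [PressureSlaving.stPreimage_slab hβ R, h0, show R * (0 : ℝ) / R = 0 by simp] at h
    exact h.of_le parabolicCylinderOpens_one_le_slab
  -- (2b) weak spatial gradient on the unit cylinder
  have hG : HasWeakSpatialGradientOn (parabolicCylinderOpens 1 ((0 : ℝ), (0 : EuclideanSpace ℝ (Fin 3)))) v G := by
    have h := hH.stRescale R hβ hR 0 (0 : EuclideanSpace ℝ (Fin 3))
    rw [PressureSlaving.stPreimage_slab hβ R] at h
    exact h.mono parabolicCylinderOpens_one_le_slab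
  -- ### (3) the data on the unit cylinder from the class at scale `R`
  obtain hgR := hgauge R hR
  have hA : cknA R (0 : ℝ × EuclideanSpace ℝ (Fin 3)) u < ⊤ :=
    lt_top_of_mul_le (ENNReal.ofReal_pos.2 (Real.rpow_pos_of_pos hR _)).ne'
      (le_trans (le_trans le_self_add le_self_add) hgR)
  have hE : cknE R (0 : ℝ × EuclideanSpace ℝ (Fin 3)) H < ⊤ :=
    lt_top_of_mul_le (ENNReal.ofReal_pos.2 (Real.rpow_pos_of_pos hR _)).ne'
      (le_trans (le_trans le_add_self le_self_add) hgR)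
  have hD : cknD R (0 : ℝ × EuclideanSpace ℝ (Fin 3)) p < ⊤ :=
    lt_top_of_mul_le (ENNReal.ofReal_pos.2 (Real.rpow_pos_of_pos hR _)).ne' (le_trans le_add_self hgR)
  have hRne : ENNReal.ofReal R ≠ 0 := (ENNReal.ofReal_pos.2 hR).ne'
  -- (3a) sliced `L²` bound
  have h2 : ∃ C : ℝ≥0, ∀ᵐ t ∂(volume.restrict (Ioo (-1 : ℝ) 0)),
      ∫⁻ x in ball (0 : EuclideanSpace ℝ (Fin 3)) 1, ‖v t x‖ₑ ^ 2 ≤ C := by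
    -- slices of `u` on `B_R` for every `t ∈ (−R², 0)`
    have hsl : ∀ t ∈ Ioo (-(R ^ 2)) (0 : ℝ), ∫⁻ x in ball (0 : EuclideanSpace ℝ (Fin 3)) R, ‖u t x‖ₑ ^ 2 ≤
        ENNReal.ofReal R * cknA R (0 : ℝ × EuclideanSpace ℝ (Fin 3)) u := by
      intro t ht
      have hle : (ENNReal.ofReal R)⁻¹ * ∫⁻ x in ball (0 : EuclideanSpace ℝ (Fin 3)) R, ‖u t x‖ₑ ^ 2 ≤
          cknA R (0 : ℝ × EuclideanSpace ℝ (Fin 3)) u := by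
        unfold cknA
        have ht' : t ∈ Ioo ((0 : ℝ) - R ^ 2) 0 := by simpa using ht
        exact le_iSup₂ (f := fun t _ => (ENNReal.ofReal R)⁻¹ *
          ∫⁻ x in ball (0 : EuclideanSpace ℝ (Fin 3)) R, ‖u t x‖ₑ ^ 2) t ht'
      exact (le_mul_inv_mul hRne ENNReal.ofReal_ne_top).trans (mul_le_mul' le_rfl hle)
    have hsl' : ∀ᵐ t ∂(volume.restrict (Ioo (0 + β * (-1)) (0 + β * 0))),
        ∫⁻ x in ball (0 : EuclideanSpace ℝ (Fin 3)) R, (fun t x => ‖u t x‖ₑ ^ 2) t x ≤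
          ENNReal.ofReal R * cknA R (0 : ℝ × EuclideanSpace ℝ (Fin 3)) u := by
      have e : Ioo (0 + β * (-1)) (0 + β * 0) = Ioo (-(R ^ 2)) (0 : ℝ) := by rw [hβdef]; ring_nf
      rw [e]
      exact (ae_restrict_iff' measurableSet_Ioo).2 (Eventually.of_forall hsl)
    have h := ae_sliced_setLIntegral_ball_stRescale hβ hR 0 (0 : EuclideanSpace ℝ (Fin 3)) 0 R (-1) 0
      (fun t x => ‖u t x‖ₑ ^ 2) hsl'
    set B : ℝ≥0∞ := ENNReal.ofReal (R ^ 2) * (ENNReal.ofReal (R ^ Module.finrank ℝ (EuclideanSpace ℝ (Fin 3)))⁻¹ *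
      (ENNReal.ofReal R * cknA R (0 : ℝ × EuclideanSpace ℝ (Fin 3)) u)) with hBdef
    have hBtop : B < ⊤ :=
      ENNReal.mul_lt_top ENNReal.ofReal_lt_top
        (ENNReal.mul_lt_top ENNReal.ofReal_lt_top (ENNReal.mul_lt_top ENNReal.ofReal_lt_top hA))
    refine ⟨B.toNNReal, ?_⟩
    rw [ENNReal.coe_toNNReal hBtop.ne]
    filter_upwards [h] with s hs
    have e1 : ball (R⁻¹ • ((0 : EuclideanSpace ℝ (Fin 3)) - 0)) (R / R) = ball (0 : EuclideanSpace ℝ (Fin 3)) 1 := by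
      rw [sub_zero, smul_zero, div_self hR.ne']
    rw [e1] at hs
    have e2 : ∀ y, ‖v s y‖ₑ ^ 2 = ENNReal.ofReal (R ^ 2) * ‖u (0 + β * s) (0 + R • y)‖ₑ ^ 2 := fun y => by
      rw [hvdef, smul_stPull_apply, enorm_smul, mul_pow, ← ofReal_norm, Real.norm_of_nonneg hR.le,
        ENNReal.ofReal_pow hR.le]
    simp_rw [e2]
    rw [lintegral_const_mul' _ _ ENNReal.ofReal_ne_top, hBdef]
    exact mul_le_mul' le_rfl hs
  -- (3b) the gradient in `L²`
  have hG2 : ∫⁻ z in parabolicCylinder 1 ((0 : ℝ), (0 : EuclideanSpace ℝ (Fin 3))),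
      ENNReal.ofReal (frobeniusNormSq (G z.1 z.2)) < ∞ := by
    have h := setLIntegral_frobeniusNormSq_stRescale hβ hR 0 (0 : EuclideanSpace ℝ (Fin 3)) (R * R) H
      (Ioo (-(R ^ 2)) 0 ×ˢ ball (0 : EuclideanSpace ℝ (Fin 3)) R)
    rw [hpre, ← hGdef] at h
    rw [hQ1, h]
    have hI : ∫⁻ z in Ioo (-(R ^ 2)) 0 ×ˢ ball (0 : EuclideanSpace ℝ (Fin 3)) R,
        ENNReal.ofReal (frobeniusNormSq (H z.1 z.2)) < ⊤ := by
      have hle : (ENNReal.ofReal R)⁻¹ * ∫⁻ z in Ioo (-(R ^ 2)) 0 ×ˢ ball (0 : EuclideanSpace ℝ (Fin 3)) R,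
          ENNReal.ofReal (frobeniusNormSq (H z.1 z.2)) < ⊤ := by
        have : cknE R (0 : ℝ × EuclideanSpace ℝ (Fin 3)) H = (ENNReal.ofReal R)⁻¹ *
            ∫⁻ z in Ioo (-(R ^ 2)) 0 ×ˢ ball (0 : EuclideanSpace ℝ (Fin 3)) R, ENNReal.ofReal (frobeniusNormSq (H z.1 z.2)) := by
          unfold cknE; rw [parabolicCylinder_zero']
        rw [← this]; exact hE
      exact lt_of_le_of_lt (le_mul_inv_mul hRne ENNReal.ofReal_ne_top)
        (ENNReal.mul_lt_top ENNReal.ofReal_lt_top hle)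
    exact ENNReal.mul_lt_top (ENNReal.mul_lt_top ENNReal.ofReal_lt_top ENNReal.ofReal_lt_top) hI
  -- (3c) the pressure in `L^{3/2}`
  have hp : ∫⁻ z in parabolicCylinder 1 ((0 : ℝ), (0 : EuclideanSpace ℝ (Fin 3))), ‖q z.1 z.2‖ₑ ^ (3 / 2 : ℝ) < ∞ := by
    have h := setLIntegral_enorm_rpow_stRescale hβ hR 0 (0 : EuclideanSpace ℝ (Fin 3)) (R ^ 2) p
      (Ioo (-(R ^ 2)) 0 ×ˢ ball (0 : EuclideanSpace ℝ (Fin 3)) R) (r := 3 / 2) (by norm_num)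
    rw [hpre, ← hqdef] at h
    rw [hQ1, h]
    have hI : ∫⁻ z in Ioo (-(R ^ 2)) 0 ×ˢ ball (0 : EuclideanSpace ℝ (Fin 3)) R, ‖p z.1 z.2‖ₑ ^ (3 / 2 : ℝ) < ⊤ := by
      have hR2ne : ENNReal.ofReal R ^ 2 ≠ 0 := pow_ne_zero _ hRne
      have hR2top : ENNReal.ofReal R ^ 2 ≠ ⊤ := ENNReal.pow_ne_top ENNReal.ofReal_ne_top
      have hle : (ENNReal.ofReal R ^ 2)⁻¹ * ∫⁻ z in Ioo (-(R ^ 2)) 0 ×ˢ ball (0 : EuclideanSpace ℝ (Fin 3)) R,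
          ‖p z.1 z.2‖ₑ ^ (3 / 2 : ℝ) < ⊤ := by
        have : cknD R (0 : ℝ × EuclideanSpace ℝ (Fin 3)) p = (ENNReal.ofReal R ^ 2)⁻¹ *
            ∫⁻ z in Ioo (-(R ^ 2)) 0 ×ˢ ball (0 : EuclideanSpace ℝ (Fin 3)) R, ‖p z.1 z.2‖ₑ ^ (3 / 2 : ℝ) := by
          unfold cknD; rw [parabolicCylinder_zero']
        rw [← this]; exact hD
      exact lt_of_le_of_lt (le_mul_inv_mul hR2ne hR2top) (ENNReal.mul_lt_top (by
        exact ENNReal.pow_lt_top ENNReal.ofReal_lt_top) hle)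
    refine ENNReal.mul_lt_top (ENNReal.mul_lt_top ?_ ENNReal.ofReal_lt_top) hI
    exact ENNReal.rpow_lt_top_of_nonneg (by norm_num) enorm_ne_top
  -- (3d) `v ∈ L⁴(Q₁)`
  have h4Q : ∫⁻ z in parabolicCylinder 1 ((0 : ℝ), (0 : EuclideanSpace ℝ (Fin 3))), ‖v z.1 z.2‖ₑ ^ (4 : ℝ) < ∞ := by
    have h := setLIntegral_enorm_rpow_stRescale hβ hR 0 (0 : EuclideanSpace ℝ (Fin 3)) R u
      (Ioo (-(R ^ 2)) 0 ×ˢ ball (0 : EuclideanSpace ℝ (Fin 3)) R) (r := 4) (by norm_num)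
    rw [hpre, ← hvdef] at h
    rw [hQ1, h]
    have hI : ∫⁻ z in Ioo (-(R ^ 2)) 0 ×ˢ ball (0 : EuclideanSpace ℝ (Fin 3)) R, ‖u z.1 z.2‖ₑ ^ (4 : ℝ) < ⊤ := by
      have e : ∀ x : ℝ≥0∞, x ^ (4 : ℝ) = x ^ (4 : ℕ) := fun x => by
        rw [← ENNReal.rpow_natCast]; norm_num
      simp_rw [e]
      exact hL4 R hR
    refine ENNReal.mul_lt_top (ENNReal.mul_lt_top ?_ ENNReal.ofReal_lt_top) hI
    exact ENNReal.rpow_lt_top_of_nonneg (by norm_num) enorm_ne_top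
  -- ### (4) the Lions gate on the unit cylinder, tested with `ψ = φ ∘ Φ`
  have hψ : IsSpaceTimeTestOn (parabolicCylinderOpens 1 ((0 : ℝ), (0 : EuclideanSpace ℝ (Fin 3)))) ψ := by
    have hφQ : IsSpaceTimeTestOn (parabolicCylinderOpens R ((0 : ℝ), (0 : EuclideanSpace ℝ (Fin 3)))) φ := by
      refine hφ.of_tsupport_subset ?_
      rw [coe_parabolicCylinderOpens, hQR]
      exact hKQ
    have h := hφQ.stPull hβ.ne' hR.ne' 0 (0 : EuclideanSpace ℝ (Fin 3))
    refine h.of_tsupport_subset (h.tsupport_subset.trans (le_of_eq ?_))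
    rw [coe_stPreimage, coe_parabolicCylinderOpens, coe_parabolicCylinderOpens, hQR, hpre, hQ1]
  have hid := integral_integral_localEnergy_eq_of_L4 (E := EuclideanSpace ℝ (Fin 3)) hNS h2 hG hG2 hp h4Q hψ
  simp only [zero_mul, zero_add, mul_zero] at hid
  -- `hid : ∫ s, ∫ y, (‖v s y‖² ∂ₛψ + ⟪v, ∇ψ⟫(‖v‖² + 2q)) = 0`
  -- ### (5) pull back: the integrand is `R⁴` times the original one at `Φ(s, y)`
  set F : ℝ → EuclideanSpace ℝ (Fin 3) → ℝ := fun t x =>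
    ‖u t x‖ ^ 2 * timeDeriv φ t x + (‖u t x‖ ^ 2 + 2 * p t x) * ⟪u t x, gradient (φ t) x⟫ with hFdef
  have hpt : ∀ s y, ‖v s y‖ ^ 2 * timeDeriv ψ s y + ⟪v s y, gradient (ψ s) y⟫ * (‖v s y‖ ^ 2 + 2 * q s y) =
      R ^ 4 * F (0 + β * s) (0 + R • y) := by
    intro s y
    have ev : v s y = R • u (0 + β * s) (0 + R • y) := by rw [hvdef, smul_stPull_apply]
    have eq' : q s y = R ^ 2 * p (0 + β * s) (0 + R • y) := by
      rw [hqdef, smul_stPull_apply, smul_eq_mul]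
    have eT : timeDeriv ψ s y = β * timeDeriv φ (0 + β * s) (0 + R • y) := by
      rw [hψdef, timeDeriv_stPull, smul_eq_mul]
    have eg : gradient (ψ s) y = R • gradient (φ (0 + β * s)) (0 + R • y) := by
      rw [hψdef]
      exact gradient_stPull β R 0 (0 : EuclideanSpace ℝ (Fin 3)) φ s y
    rw [ev, eq', eT, eg, hFdef, norm_smul, Real.norm_of_nonneg hR.le, real_inner_smul_left, real_inner_smul_right, hβdef]
    ring
  have hid' : ∫ s, ∫ y, R ^ 4 * F (0 + β * s) (0 + R • y) = 0 := by
    have e : (fun s => ∫ y, ‖v s y‖ ^ 2 * timeDeriv ψ s y + ⟪v s y, gradient (ψ s) y⟫ * (‖v s y‖ ^ 2 + 2 * q s y)) =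
        fun s => ∫ y, R ^ 4 * F (0 + β * s) (0 + R • y) := by
      funext s
      exact integral_congr_ae (Eventually.of_forall (hpt s))
    rw [← e]
    exact hid
  have hcv := integral_integral_comp_stAffine hβ hR 0 (0 : EuclideanSpace ℝ (Fin 3)) F
  -- `∫ s ∫ y F(Φ) = (β R³)⁻¹ • ∫ t ∫ x F`
  have hscal : ∫ s, ∫ y, R ^ 4 * F (0 + β * s) (0 + R • y) = R ^ 4 * ∫ s, ∫ y, F (0 + β * s) (0 + R • y) := by
    rw [← integral_const_mul]
    refine integral_congr_ae (Eventually.of_forall fun s => ?_)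
    exact integral_const_mul _ _
  rw [hscal, hcv, smul_eq_mul, finrank_euclideanSpace_fin] at hid'
  have hne : R ^ 4 * (β * R ^ 3)⁻¹ ≠ 0 := by positivity
  have : ∫ t, ∫ x, F t x = 0 := by
    have h := hid'
    rw [← mul_assoc] at h
    rcases mul_eq_zero.1 h with h1 | h1
    · exact absurd h1 hne
    · exact h1
  simpa only [hFdef] using this


/-! ### O1 ∘ O2: `L⁴_loc` members have the exact window identity (appended) -/

/-- **`L⁴_loc` MEMBERS HAVE THE EXACT WINDOW IDENTITY** (lines `lions_gate` O1 ∘ O2, by name: this file's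
`isEnergyConservative_of_memL4Loc` ∘ ns-ezl-w6's `WindowIdentity.hasWindowIdentity_of_isEnergyConservative`): for a member of the class with
`u ∈ L⁴((−a²,0) × B_a)` for every `a > 0` and every smooth compactly supported `χ`, off a null set of times,
`E_χ(σ) − E_χ(s) = ∫_s^σ ∫ (|u|² + 2p)⟪u, ∇χ⟩` — no anomalous dissipation inside the `L⁴` part of the class. [folklore] -/
theorem hasWindowIdentity_of_memL4Loc (ρ : ℝ)
    (u : ℝ → EuclideanSpace ℝ (Fin 3) → EuclideanSpace ℝ (Fin 3)) (p : ℝ → EuclideanSpace ℝ (Fin 3) → ℝ)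
    (H : ℝ → EuclideanSpace ℝ (Fin 3) → EuclideanSpace ℝ (Fin 3) →L[ℝ] EuclideanSpace ℝ (Fin 3)) (c : ℝ≥0)
    (hcls : IsSuitableWeakSolutionOn (slab (EuclideanSpace ℝ (Fin 3)) (Set.Iio 0) isOpen_Iio) 0 0 u p ∧
      HasWeakSpatialGradientOn (slab (EuclideanSpace ℝ (Fin 3)) (Set.Iio 0) isOpen_Iio) u H ∧
      (∀ a : ℝ, 0 < a →
        ENNReal.ofReal (a ^ (2 * ρ)) * cknA a (0 : ℝ × EuclideanSpace ℝ (Fin 3)) u +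
            ENNReal.ofReal (a ^ ρ) * cknE a (0 : ℝ × EuclideanSpace ℝ (Fin 3)) H +
          ENNReal.ofReal (a ^ (2 * ρ)) * cknD a (0 : ℝ × EuclideanSpace ℝ (Fin 3)) p ≤ (c : ℝ≥0∞)))
    (hL4 : ∀ a : ℝ, 0 < a →
      ∫⁻ z in Set.Ioo (-(a ^ 2)) 0 ×ˢ Metric.ball (0 : EuclideanSpace ℝ (Fin 3)) a, ‖u z.1 z.2‖ₑ ^ (4 : ℕ) < ⊤) :
    ∀ χ : EuclideanSpace ℝ (Fin 3) → ℝ, ContDiff ℝ (⊤ : ℕ∞) χ → HasCompactSupport χ →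
      ∃ N : Set ℝ, volume N = 0 ∧ ∀ s σ : ℝ, s < σ → σ < 0 → s ∉ N → σ ∉ N →
        (∫ x, χ x * ‖u σ x‖ ^ 2) - (∫ x, χ x * ‖u s x‖ ^ 2) =
          ∫ τ in Set.Ioo s σ, ∫ x, (‖u τ x‖ ^ 2 + 2 * p τ x) * ⟪u τ x, gradient χ x⟫ :=
  WindowIdentity.hasWindowIdentity_of_isEnergyConservative hcls (isEnergyConservative_of_memL4Loc ρ u p H c hcls hL4)

end Summit.NavierStokesRegularity.NavierStokesRegularity.Theorems.PowerGaugeEulerLiouville.LionsGate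

end
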